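import Summits.CriticalPhenomena.CardyFormulaZ2.Theorems.CardyMagicRigidityNestingRigidityFirstGenStoppingZ2
import Summits.CriticalPhenomena.CardyFormulaZ2.Theorems.CardyMagicRigidityNestingRigidityOneGenerationZ2Indep
import HarnessLib

/-!
# Domain Markov property of the closed-b.c. `ℤ²` domain ensemble, law form

Crux `Summit.CriticalPhenomena.CardyFormulaZ2.Theses.CardyMagicRigidity.NestingRigidity`
(stmt-CriticalPhenomena-4835), line `markov-cascade-one-generation`, registered helper
`firstGen_domLoopsZ2_markov` (wave 4, toward `stub_cascadeReconstruction`), over the definitions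
module `CardyMagicRigidityMarkovCascadeDefs` (`P2`, `domLoopsZ2`, `firstGen`, `meshEdges`).

**Statement.** For `δ > 0`, bounded `U`, a loop configuration `c₀` and the set
`S = {e | ∃ u ∈ c₀.loops, u.wind (medialPoint δ e) ≠ 0}` of edges whose mesh-`δ` midpoint is
strictly inside a loop of `c₀`: the event `E = {firstGen (domLoopsZ2 U δ ·) = c₀}` is independent
under `P2 = P_{1/2}` of every measurable event `B = {ω | ω ∩ S ∈ A}` of the coordinates in `S`:
`P2 (E ∩ B) = P2 E * P2 B`.  Conditionally on the first generation being `c₀`, the edges strictly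
inside the first-generation loops carry fresh product percolation.

**Proof.** By the stopping-set lemma `firstGen_domLoopsZ2_eq_of_agree_outside` (module
`…FirstGenStoppingZ2`) and locality of the domain ensemble (`domLoopsZ2_inter_meshEdges`: only the
finitely many edges of `meshEdges U δ` are read), `E` is determined by the coordinates in the FINITE
set `Sᶜ ∩ meshEdges U δ` (`firstGen_domLoopsZ2_eq_of_inter_eq`), which is disjoint from `S`; `B` is
determined by the coordinates in `S`; disjoint families of coordinates are independent under the
product measure (`bondPercolation_inter_of_determinedBy`, module `…OneGenerationZ2Indep`).
-/

noncomputable section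

open MeasureTheory Set

namespace Summit.CriticalPhenomena.CardyFormulaZ2.Cruxes.NestingRigidity.MarkovCascadeOneGeneration

open Literature.Probability.RandomPlanarGeometry Literature.Probability.Percolation
  Literature.Probability.LatticeModels

/-- **`{firstGen (domLoopsZ2 U δ ·) = c₀}` is determined by the coordinates off the strict
interiors of the loops of `c₀`, within `meshEdges U δ`**: if `firstGen (domLoopsZ2 U δ ω) = c₀` and
`ω'` agrees with `ω` on every edge of `meshEdges U δ` whose mesh-`δ` midpoint is strictly inside no
loop of `c₀`, then `firstGen (domLoopsZ2 U δ ω') = c₀` (stopping-set lemma applied to the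
restrictions `ω ∩ meshEdges U δ`, `ω' ∩ meshEdges U δ`, which have the same domain ensembles). -/
theorem firstGen_domLoopsZ2_eq_of_inter_eq {U : Set ℂ} {δ : ℝ} {c₀ : LoopConfig ℂ}
    {ω ω' : BondConfig (Site 2)} (hδ : 0 < δ) (hU : Bornology.IsBounded U)
    (h : ω ∩ ({e | ∃ u ∈ c₀.loops, u.wind (medialPoint δ e) ≠ 0}ᶜ ∩ meshEdges U δ) =
      ω' ∩ ({e | ∃ u ∈ c₀.loops, u.wind (medialPoint δ e) ≠ 0}ᶜ ∩ meshEdges U δ))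
    (hω : firstGen (domLoopsZ2 U δ ω) = c₀) : firstGen (domLoopsZ2 U δ ω') = c₀ := by
  have hω₁ : firstGen (domLoopsZ2 U δ (ω ∩ meshEdges U δ)) = c₀ := by
    rw [domLoopsZ2_inter_meshEdges, hω]
  have key := firstGen_domLoopsZ2_eq_of_agree_outside U δ (ω ∩ meshEdges U δ)
    (ω' ∩ meshEdges U δ) hδ hU ?_
  · rwa [domLoopsZ2_inter_meshEdges, domLoopsZ2_inter_meshEdges, hω] at key
  intro e he
  rw [hω₁] at he
  have heS : e ∈ {e | ∃ u ∈ c₀.loops, u.wind (medialPoint δ e) ≠ 0}ᶜ := by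
    rintro ⟨u, hu, hne⟩
    exact hne (he u hu)
  by_cases heM : e ∈ meshEdges U δ
  · have hiff := Set.ext_iff.1 h e
    simp only [mem_inter_iff] at hiff ⊢
    constructor
    · rintro ⟨heω, -⟩
      exact ⟨(hiff.1 ⟨heω, heS, heM⟩).1, heM⟩
    · rintro ⟨heω', -⟩
      exact ⟨(hiff.2 ⟨heω', heS, heM⟩).1, heM⟩
  · exact ⟨fun h' ↦ (heM h'.2).elim, fun h' ↦ (heM h'.2).elim⟩

/-- `{firstGen (domLoopsZ2 U δ ·) = c₀}` is `DeterminedBy` the finite coordinate set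
`Sᶜ ∩ meshEdges U δ`, `S` the edges strictly inside a loop of `c₀`. -/
theorem determinedBy_firstGen_domLoopsZ2_eq {U : Set ℂ} {δ : ℝ} (c₀ : LoopConfig ℂ) (hδ : 0 < δ)
    (hU : Bornology.IsBounded U) :
    DeterminedBy {ω : BondConfig (Site 2) | firstGen (domLoopsZ2 U δ ω) = c₀}
      ({e | ∃ u ∈ c₀.loops, u.wind (medialPoint δ e) ≠ 0}ᶜ ∩ meshEdges U δ) :=
  (determinedBy_iff _ _).2 fun _ _ h ↦
    ⟨firstGen_domLoopsZ2_eq_of_inter_eq hδ hU h, firstGen_domLoopsZ2_eq_of_inter_eq hδ hU h.symm⟩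

/-- A cylinder event `{ω | ω ∩ S ∈ A}` of the coordinates in `S` is `DeterminedBy S`. -/
theorem determinedBy_setOf_inter_mem {ι : Type*} (S : Set ι) (A : Set (Set ι)) :
    DeterminedBy {ω : Set ι | ω ∩ S ∈ A} S :=
  (determinedBy_iff _ _).2 fun ω ω' h ↦ by rw [mem_setOf_eq, mem_setOf_eq, h]

/-- **Domain Markov property of the closed-b.c. bond-`ℤ²` domain ensemble, law form** (registered
helper `firstGen_domLoopsZ2_markov`, wave 4, toward `stub_cascadeReconstruction`): for `δ > 0` and
bounded `U`, the event that the first generation of `domLoopsZ2 U δ` equals `c₀` is independent,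
under critical bond percolation `P2`, of every measurable event of the coordinates strictly inside
the loops of `c₀` — given the first generation, the inside edges are fresh product percolation. -/
theorem firstGen_domLoopsZ2_markov : ∀ (U : Set ℂ) (δ : ℝ) (c₀ : LoopConfig ℂ) (A : Set (Set (Sym2 (Site 2)))), 0 < δ → Bornology.IsBounded U → MeasurableSet {ω : BondConfig (Site 2) | ω ∩ {e | ∃ u ∈ c₀.loops, u.wind (medialPoint δ e) ≠ 0} ∈ A} → P2 ({ω | firstGen (domLoopsZ2 U δ ω) = c₀} ∩ {ω | ω ∩ {e | ∃ u ∈ c₀.loops, u.wind (medialPoint δ e) ≠ 0} ∈ A}) = P2 {ω | firstGen (domLoopsZ2 U δ ω) = c₀} * P2 {ω | ω ∩ {e | ∃ u ∈ c₀.loops, u.wind (medialPoint δ e) ≠ 0} ∈ A} := by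
  intro U δ c₀ A hδ hU hBm
  exact bondPercolation_inter_of_determinedBy (zdGraph 2) half
    ((meshEdges_finite hU hδ).subset inter_subset_right)
    (disjoint_compl_left.mono_left inter_subset_left)
    (determinedBy_firstGen_domLoopsZ2_eq c₀ hδ hU) (determinedBy_setOf_inter_mem _ A) hBm

end Summit.CriticalPhenomena.CardyFormulaZ2.Cruxes.NestingRigidity.MarkovCascadeOneGeneration

end
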